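import Summits.ResolutionOfSingularities.ResolutionOfSingularities.Theorems.WeightedInvariantWeightedThesisHypersurfaceTowerChoice
import Summits.ResolutionOfSingularities.ResolutionOfSingularities.Theorems.WeightedInvariantWeightedThesisHypersurfaceChoiceTTower
import HarnessLib

/-!
# Crux `WeightedThesis` (stmt-ResolutionOfSingularities-0569): TOWER-INDEXED choices in every transversal dimension suffice

Topic: `Summits/ResolutionOfSingularities/ResolutionOfSingularities/Theorems`. Route
`ResolutionOfSingularities/WeightedInvariant`, crux `Theses.WeightedInvariant.WeightedThesis`, line
`datum-glued-split`, lead c9, RESHAPE 11 — the tower and the composition for the tower-indexed ladder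
`HypersurfaceTowerChoiceDim p e` (`Theorems/…HypersurfaceTowerChoice.lean`: a centre for every TOWER, with
`(iii)`, `(ii')`, `(H_τ)` homogeneity on the charts of the tower, `(T)`, on the runs of the rule started at an
`e`-dimensional hypersurface).

Włodarczyk's cobordant tower is run ON TOWER DATA: well-founded induction on "extend a run started in dimension
`e` by its prescribed step" (property `(T)`), the state being `σ = ⟨P, τ⟩` (a pair with a tower ending at it)
together with a torus-quotient presentation of the hypersurface whose graded atlas consists of charts OF THE
TOWER (`Tower.IsChart`). No `subst` of the hypersurface ideal is possible under the tower, so the presentation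
`i : X ⟶ P.Y` is carried with the propositional equation `i.ker = P.X` and the step facts are transported
along it.

* `HypersurfaceTowerChoiceTower.hasResolution_quotient_of_gradedAtlas` — the tower;
* `HypersurfaceTowerChoiceTower.hasResolution_hypersurface_of_towerChoiceDim_field`,
  `HypersurfaceTowerChoiceTower.hasResolution_of_towerChoiceDim_field`,
  `HypersurfaceTowerChoiceTower.resolution_field_iff_berghRydh_field_of_towerChoiceDim` — field-wise;
* `perfectResolution_of_hypersurfaceTowerChoiceDim_of_forall_berghRydh_charP` (registered stub of the line,
  RESHAPE 11; the crux unfolded) and `weightedThesis_of_hypersurfaceTowerChoiceDim_of_forall_berghRydh_charP` (by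
  name) — **`(∀ p prime, ∀ e, Nonempty (HypersurfaceTowerChoiceDim p e))` and the characteristic-`p` instances of
  Bergh–Rydh give `WeightedThesis`**; the RESHAPE 10 ladder factors through it
  (`HypersurfaceTowerChoiceDim.ofChoiceTDim`).
-/

noncomputable section

open CategoryTheory CategoryTheory.Limits AlgebraicGeometry TopologicalSpace
open Literature.AlgebraicGeometry.Resolution
open Summit.ResolutionOfSingularities.ResolutionOfSingularities.Theses.WeightedInvariant
open Summit.ResolutionOfSingularities.ResolutionOfSingularities.Theorems

set_option linter.dupNamespace false -- mandated namespace of this single-conjunct summit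

/-! ## The tower on tower data -/

namespace Summit.ResolutionOfSingularities.ResolutionOfSingularities.Theorems.HypersurfaceTowerChoiceTower

/-- **Every torus-quotient presentation BY CHARTS OF THE TOWER of the end hypersurface of a run started in
dimension `e` has a resolved quotient, granted a tower-indexed choice in transversal dimension `e` at
`p = char k` and Bergh–Rydh over `k`**: well-founded induction on "extend a run from dimension `e` by its
prescribed step" (property `(T)`) over the states `⟨P, τ⟩`. Base (end hypersurface regular): quotient
singularities and Bergh–Rydh. Step: `(iii)`, `(ii')` for the run; `(H_τ)` on the charts of the atlas, which are
charts of the tower; the tower-typed quotient step returns the successor atlas with each chart a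
`TowerChartStep` over an old one, hence a chart of the extended tower (`IsChart.of_step`); the extended tower is
again a run from the same start, and below in the relation: the induction hypothesis resolves the new quotient,
and the old one along the blow-up. [cite: Wlodarczyk2022, Thm 1.1.4 (5), Thm 1.1.6; BerghRydh2019, Thm 5] -/
theorem hasResolution_quotient_of_gradedAtlas
    {p e : ℕ} (C : HypersurfaceTowerChoiceDim p e) {k : Type} [Field k] [CharP k p] [PerfectField k]
    (hBR : ∀ (V : Scheme.{0}) (g : V ⟶ Spec (.of k)) [IsIntegral V] [IsSeparated g]
      [LocallyOfFiniteType g] [QuasiCompact g],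
      (∀ v : V, ∃ (A : Type) (_ : AddCommGroup A) (_ : Finite A) (_ : DecidableEq A)
        (S : Type) (_ : CommRing S) (_ : Algebra k S) (𝒮 : A → Submodule k S)
        (_ : GradedAlgebra 𝒮), Algebra.FiniteType k S ∧ Algebra.Smooth k S ∧
        ∃ φ : Spec (.of (𝒮 0)) ⟶ V, Etale φ ∧ v ∈ Set.range φ ∧
          φ ≫ g = Spec.map (CommRingCat.ofHom (algebraMap k (𝒮 0)))) →
      Scheme.HasResolution V)
    (σ : Σ P : HypersurfacePair k, HypersurfacePair.Tower P) :
    σ.2.IsRun (C.centre (k := k)) →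
    topologicalKrullDim σ.2.startPair.X.subscheme = (e : WithBot ℕ∞) →
    ∀ (X V : Scheme.{0}) (i : X ⟶ σ.1.Y) [IsClosedImmersion i] [IsIntegral X], i.ker = σ.1.X →
      ∀ (g : V ⟶ Spec (.of k)) [IsSeparated g] [LocallyOfFiniteType g] [QuasiCompact g]
        [IsIntegral V] (q : X ⟶ V), q ≫ g = i ≫ σ.1.f → ∀ (j : ℕ) (𝒜 : GradedAtlas j σ.1.f i q),
        (∀ a : 𝒜.ι, σ.2.IsChart j (𝒜.W a) (𝒜.piece a)) → Scheme.HasResolution V := by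
  refine (C.wellFounded_step (k := k)).induction
    (C := fun σ : (Σ P : HypersurfacePair k, HypersurfacePair.Tower P) =>
      σ.2.IsRun (C.centre (k := k)) →
      topologicalKrullDim σ.2.startPair.X.subscheme = (e : WithBot ℕ∞) →
      ∀ (X V : Scheme.{0}) (i : X ⟶ σ.1.Y) [IsClosedImmersion i] [IsIntegral X], i.ker = σ.1.X →
        ∀ (g : V ⟶ Spec (.of k)) [IsSeparated g] [LocallyOfFiniteType g] [QuasiCompact g]
          [IsIntegral V] (q : X ⟶ V), q ≫ g = i ≫ σ.1.f → ∀ (j : ℕ) (𝒜 : GradedAtlas j σ.1.f i q),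
          (∀ a : 𝒜.ι, σ.2.IsChart j (𝒜.W a) (𝒜.piece a)) → Scheme.HasResolution V) σ ?_
  rintro ⟨P, τ⟩ ih hrun he X V i _ _ hIeq g _ _ _ _ q hq j 𝒜 h𝒜
  dsimp only at hrun he i hIeq q hq 𝒜 h𝒜
  -- notation for the current pair
  let Y : Scheme.{0} := P.Y
  let f : Y ⟶ Spec (.of k) := P.f
  change X ⟶ Y at i
  by_cases hreg : Scheme.IsRegular X
  · -- base: `X` regular ⇒ quotient singularities ⇒ Bergh–Rydh over `k`
    exact hBR V g (DatumToEmbedded.quotientSingularities_of_regular f i q g hq hreg 𝒜)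
  · -- step
    have hsingK : ¬ Scheme.IsRegular i.ker.subscheme := fun h =>
      hreg ((isRegular_iff_isRegular_image i).mpr h)
    have hsingP : ¬ Scheme.IsRegular P.X.subscheme := hIeq ▸ hsingK
    haveI : IsLocallyNoetherian Y := LocallyOfFiniteType.isLocallyNoetherian f
    have hY : Scheme.IsRegular Y := Scheme.IsRegular.of_smooth f (Scheme.isRegular_Spec (.of k))
    have hIker : IsLocallyPrincipal i.ker := hIeq ▸ P.isLocallyPrincipal
    -- `(iii)`, `(ii')` for the run: a regular weighted centre off the generic point of `X`
    let R : ReesAlgebraData Y := C.centre τ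
    have hc : R.IsRegularWeightedCentre := C.isRegularWeightedCentre_centre τ hrun he hsingP
    have hξ : i (genericPoint X) ∉ R.support :=
      C.genericPoint_not_mem_support_centre τ hrun he i hIeq hreg
    -- the Rees filtration of the centre
    let R' : ReesFiltration Y :=
      { ideal := R.piece
        ideal_zero := R.piece_zero
        antitone := antitone_piece hc
        mul_le := R.piece_mul_le }
    -- the new ambient is smooth separated quasi-compact
    obtain ⟨hsm', hsep', hqc'⟩ :=
      WeightedThesis.GlobalCobordantPlus.smooth_πPlus_comp_of_isRegularWeightedCentre f R hc R' rfl
    haveI := hsm'; haveI := hsep'; haveI := hqc'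
    -- the strict transform is integral and lies over `X`
    obtain ⟨hint', hker⟩ :=
      DatumToEmbedded.StrictTransform.isIntegral_strictTransformPlus_of_not_mem_support i R hc R' rfl hξ
    haveI := hint'
    -- the successor is a hypersurface pair
    have hI'lp : IsLocallyPrincipal (R'.strictTransformPlus i.ker) :=
      WeightedThesis.HypersurfacePreserved.isLocallyPrincipal_strictTransformPlus hY R hc R' rfl i.ker hIker
    have hI'i : IsIntegral (R'.strictTransformPlus i.ker).subscheme := hint'
    have hI'lpP : IsLocallyPrincipal (R'.strictTransformPlus P.X) := hIeq ▸ hI'lp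
    have hI'iP : IsIntegral (R'.strictTransformPlus P.X).subscheme := hIeq ▸ hI'i
    let i' := (R'.strictTransformPlus i.ker).subschemeι
    let σX : (R'.strictTransformPlus i.ker).subscheme ⟶ X :=
      IsClosedImmersion.lift i (i' ≫ R'.πPlus) hker
    have hσX : σX ≫ i = i' ≫ R'.πPlus := IsClosedImmersion.lift_fac _ _ _
    -- `(H_τ)`: homogeneity of the prescribed centre on the charts of the atlas, which are charts of the tower
    have hXhom : ∀ a : 𝒜.ι, @Ideal.IsHomogeneous (Fin j → ℤ) (AddSubgroup Γ(Y, 𝒜.W a)) Γ(Y, 𝒜.W a)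
        _ _ _ (𝒜.piece a) _ _ (𝒜.gradedRing a) ((P.X).ideal (𝒜.W a)) := fun a =>
      hIeq ▸ 𝒜.isHomogeneous_ker a
    have hhom := fun (a : 𝒜.ι) (n : ℕ) =>
      @HypersurfaceTowerChoiceDim.centre_isHomogeneous_chart p e C k _ _ _ P τ hrun he hsingP j
        (𝒜.W a) (𝒜.piece a) (𝒜.gradedRing a) (h𝒜 a) (hXhom a) n
    -- the tower-typed quotient step
    obtain ⟨K, hK, hstep⟩ := DatumToEmbedded.quotientStep_towerTyped f i q g hq 𝒜 R hc hξ hhom R' rfl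
      σX hσX
    -- blow `V` up along `K`
    obtain ⟨V', ρ, hρ⟩ := exists_isBlowup V K
    haveI : IsLocallyNoetherian V := LocallyOfFiniteType.isLocallyNoetherian g
    haveI : IsProper ρ := hρ.isProper
    have hbir : IsBirational ρ := hρ.isBirational' hK
    haveI : IsIntegral V' := hρ.isIntegral hK
    obtain ⟨q', hq', 𝒜', h𝒜'⟩ := hstep V' ρ hρ
    -- the extended tower: a run from the same start, one step below
    let τ' := τ.step R' hsm' hsep' hqc' hI'lpP hI'iP
    have hrun' : τ'.IsRun (C.centre (k := k)) := ⟨hrun, hsingP, rfl⟩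
    have he' : topologicalKrullDim τ'.startPair.X.subscheme = (e : WithBot ℕ∞) := he
    have hrel : (fun σ' σ : (Σ P : HypersurfacePair k, HypersurfacePair.Tower P) =>
        σ.2.IsRun (C.centre (k := k)) ∧
        topologicalKrullDim σ.2.startPair.X.subscheme = (e : WithBot ℕ∞) ∧
        ¬ Scheme.IsRegular σ.1.X.subscheme ∧
        ∃ (R' : ReesFiltration σ.1.Y) (_ : R'.ideal = (C.centre σ.2).piece)
          (hs : Smooth (R'.πPlus ≫ σ.1.f)) (hsep : IsSeparated (R'.πPlus ≫ σ.1.f))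
          (hqc : QuasiCompact (R'.πPlus ≫ σ.1.f))
          (hlp : IsLocallyPrincipal (R'.strictTransformPlus σ.1.X))
          (hint : IsIntegral (R'.strictTransformPlus σ.1.X).subscheme),
          σ' = ⟨_, σ.2.step R' hs hsep hqc hlp hint⟩) ⟨_, τ'⟩ ⟨P, τ⟩ :=
      ⟨hrun, he, hsingP, R', rfl, hsm', hsep', hqc', hI'lpP, hI'iP, rfl⟩
    -- the charts of the new atlas are charts of the extended tower
    have h𝒜'T : ∀ b : 𝒜'.ι, τ'.IsChart (j + 1) (𝒜'.W b) (𝒜'.piece b) := by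
      intro b
      obtain ⟨a, hab⟩ := h𝒜' b
      exact HypersurfacePair.Tower.IsChart.of_step (h𝒜 a) (𝒜'.W b) (𝒜'.piece b) hab
    -- the induction hypothesis resolves the new quotient
    have hkerI' : i'.ker = (P.succ R' hsm' hsep' hqc' hI'lpP hI'iP).X := by
      change ((R'.strictTransformPlus i.ker).subschemeι).ker = R'.strictTransformPlus P.X
      rw [Scheme.IdealSheafData.ker_subschemeι, hIeq]
    have hV' : Scheme.HasResolution V' := by
      have hQ' := ih ⟨_, τ'⟩ hrel hrun' he'
      refine hQ' (R'.strictTransformPlus i.ker).subscheme V' i' hkerI' (ρ ≫ g) q' ?_ (j + 1) 𝒜' h𝒜'T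
      change q' ≫ ρ ≫ g = i' ≫ R'.πPlus ≫ f
      rw [← Category.assoc, hq', Category.assoc, hq, ← Category.assoc, hσX, Category.assoc]
    exact Scheme.HasResolution.of_isBirational ρ hbir hV'

/-! ## Tower-indexed choices in every transversal dimension + Bergh–Rydh over `k` ⇒ resolution over `k` -/

/-- **Tower-indexed hypersurface centre choices in every transversal dimension (in characteristic `p`) and
Bergh–Rydh over the perfect field `k` of characteristic `p` resolve every integral HYPERSURFACE of every smooth
separated quasi-compact `k`-scheme**: the EMPTY tower at `(Y, ker i)` is a run started in dimension
`e = dim V(ker i)`, and the trivial presentation of rank `0` consists of charts of the empty tower (its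
`ℤ⁰`-grading is trivial, `hyp_mem_of_gradedRing_fin_zero`). [cite: Wlodarczyk2022, Thm 1.1.6; BerghRydh2019, Thm 5] -/
theorem hasResolution_hypersurface_of_towerChoiceDim_field
    {p : ℕ} (C : ∀ e : ℕ, HypersurfaceTowerChoiceDim p e) {k : Type} [Field k] [CharP k p]
    [PerfectField k]
    (hBR : ∀ (V : Scheme.{0}) (g : V ⟶ Spec (.of k)) [IsIntegral V] [IsSeparated g]
      [LocallyOfFiniteType g] [QuasiCompact g],
      (∀ v : V, ∃ (A : Type) (_ : AddCommGroup A) (_ : Finite A) (_ : DecidableEq A)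
        (S : Type) (_ : CommRing S) (_ : Algebra k S) (𝒮 : A → Submodule k S)
        (_ : GradedAlgebra 𝒮), Algebra.FiniteType k S ∧ Algebra.Smooth k S ∧
        ∃ φ : Spec (.of (𝒮 0)) ⟶ V, Etale φ ∧ v ∈ Set.range φ ∧
          φ ≫ g = Spec.map (CommRingCat.ofHom (algebraMap k (𝒮 0)))) →
      Scheme.HasResolution V)
    {Y X : Scheme.{0}} (f : Y ⟶ Spec (.of k)) [Smooth f] [IsSeparated f] [QuasiCompact f]
    (i : X ⟶ Y) [IsClosedImmersion i] [IsIntegral X] (hX : IsLocallyPrincipal i.ker) :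
    Scheme.HasResolution X := by
  obtain ⟨𝒜₀⟩ := DatumToEmbedded.InitialAtlas.stub_initialAtlas f i
  haveI : IsSeparated (i ≫ f) := inferInstance
  haveI : LocallyOfFiniteType (i ≫ f) := inferInstance
  haveI : QuasiCompact (i ≫ f) := inferInstance
  obtain ⟨e, he⟩ := hyp_exists_nat_topologicalKrullDim_ker_subscheme f i
  refine hasResolution_quotient_of_gradedAtlas (C e) hBR
    ⟨HypersurfacePair.ofKer f i hX, HypersurfacePair.Tower.start _⟩ trivial he X X i rfl (i ≫ f) (𝟙 X)
    (Category.id_comp _) 0 𝒜₀ ?_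
  intro a
  exact HypersurfacePair.Tower.IsChart.of_start (HypersurfacePair.ofKer f i hX) (𝒜₀.W a) (𝒜₀.piece a)
    (fun v x => @hyp_mem_of_gradedRing_fin_zero _ _ (𝒜₀.piece a) (𝒜₀.gradedRing a) v x)

/-- **Tower-indexed choices in every transversal dimension and Bergh–Rydh over the perfect field `k` of
characteristic `p` resolve every reduced separated `k`-scheme of finite type** (hypersurface reduction of the
line, `HypersurfacesIff.hasResolution_of_hypersurfaces`).
[cite: Wlodarczyk2022, Thm 1.1.6; BerghRydh2019, Thm 5; Kollar2007, Prop. 2.48 (proof)] -/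
theorem hasResolution_of_towerChoiceDim_field
    {p : ℕ} (hp : p.Prime) (C : ∀ e : ℕ, HypersurfaceTowerChoiceDim p e) {k : Type} [Field k]
    [CharP k p] [PerfectField k]
    (hBR : ∀ (V : Scheme.{0}) (g : V ⟶ Spec (.of k)) [IsIntegral V] [IsSeparated g]
      [LocallyOfFiniteType g] [QuasiCompact g],
      (∀ v : V, ∃ (A : Type) (_ : AddCommGroup A) (_ : Finite A) (_ : DecidableEq A)
        (S : Type) (_ : CommRing S) (_ : Algebra k S) (𝒮 : A → Submodule k S)
        (_ : GradedAlgebra 𝒮), Algebra.FiniteType k S ∧ Algebra.Smooth k S ∧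
        ∃ φ : Spec (.of (𝒮 0)) ⟶ V, Etale φ ∧ v ∈ Set.range φ ∧
          φ ≫ g = Spec.map (CommRingCat.ofHom (algebraMap k (𝒮 0)))) →
      Scheme.HasResolution V)
    (X : Scheme.{0}) (f : X ⟶ Spec (.of k)) [IsSeparated f] [LocallyOfFiniteType f]
    [QuasiCompact f] [IsReduced X] : Scheme.HasResolution X :=
  Summit.ResolutionOfSingularities.ResolutionOfSingularities.Theorems.WeightedThesis.HypersurfacesIff.hasResolution_of_hypersurfaces hp k
    (fun Y H g j hg hs hq hj hint hpr => by
      haveI := hg; haveI := hs; haveI := hq; haveI := hj; haveI := hint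
      exact hasResolution_hypersurface_of_towerChoiceDim_field C hBR g j
        (isLocallyPrincipal_of_forall_isPrincipal hpr)) X f

/-- **The field-wise residue of the crux with tower-indexed choices in every transversal dimension.** Over a
perfect field `k` of characteristic `p` carrying `C e : HypersurfaceTowerChoiceDim p e` for every `e`,
resolution of every reduced separated `k`-scheme of finite type is EQUIVALENT to Bergh–Rydh over `k`.
[cite: Wlodarczyk2022, Thm 1.1.6; BerghRydh2019, Thm 5] -/
theorem resolution_field_iff_berghRydh_field_of_towerChoiceDim
    {p : ℕ} (hp : p.Prime) (C : ∀ e : ℕ, HypersurfaceTowerChoiceDim p e) (k : Type) [Field k]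
    [CharP k p] [PerfectField k] :
    (∀ (X : Scheme.{0}) (f : X ⟶ Spec (.of k)), IsSeparated f → LocallyOfFiniteType f →
      QuasiCompact f → IsReduced X → Scheme.HasResolution X) ↔
    ∀ (V : Scheme.{0}) (g : V ⟶ Spec (.of k)) [IsIntegral V] [IsSeparated g]
      [LocallyOfFiniteType g] [QuasiCompact g],
      (∀ v : V, ∃ (A : Type) (_ : AddCommGroup A) (_ : Finite A) (_ : DecidableEq A)
        (S : Type) (_ : CommRing S) (_ : Algebra k S) (𝒮 : A → Submodule k S)
        (_ : GradedAlgebra 𝒮), Algebra.FiniteType k S ∧ Algebra.Smooth k S ∧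
        ∃ φ : Spec (.of (𝒮 0)) ⟶ V, Etale φ ∧ v ∈ Set.range φ ∧
          φ ≫ g = Spec.map (CommRingCat.ofHom (algebraMap k (𝒮 0)))) →
      Scheme.HasResolution V :=
  ⟨Summit.ResolutionOfSingularities.ResolutionOfSingularities.Theorems.WeightedThesis.BerghRydhCharP.berghRydh_field_of_resolution_field,
    fun hBR X f hs hl hq hr => by
    haveI := hs; haveI := hl; haveI := hq; haveI := hr
    exact hasResolution_of_towerChoiceDim_field hp C hBR X f⟩

end Summit.ResolutionOfSingularities.ResolutionOfSingularities.Theorems.HypersurfaceTowerChoiceTower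

namespace Summit.ResolutionOfSingularities.ResolutionOfSingularities.Theorems

/-! ## The crux from tower-indexed choices in every transversal dimension and prime-wise Bergh–Rydh -/

/-- **Resolution over every perfect field of positive characteristic from TOWER-INDEXED hypersurface centre choices in
every transversal dimension and the characteristic-`p` instances of Bergh–Rydh** (registered stub of line
`datum-glued-split`, RESHAPE 11, crux stmt-0569; the conclusion is the crux `WeightedThesis` UNFOLDED, so that this port is not
itself read as a skeleton of the crux). [cite: Wlodarczyk2022, Thm 1.1.6; BerghRydh2019, Thm 5] -/
theorem perfectResolution_of_hypersurfaceTowerChoiceDim_of_forall_berghRydh_charP : (∀ p : ℕ, p.Prime → ∀ e : ℕ, Nonempty (Summit.ResolutionOfSingularities.ResolutionOfSingularities.Theorems.HypersurfaceTowerChoiceDim p e)) → (∀ p : ℕ, p.Prime → ∀ (k : Type) [Field k] [CharP k p] [PerfectField k] (V : AlgebraicGeometry.Scheme.{0}) (g : V ⟶ AlgebraicGeometry.Spec (.of k)) [AlgebraicGeometry.IsIntegral V] [AlgebraicGeometry.IsSeparated g] [AlgebraicGeometry.LocallyOfFiniteType g] [AlgebraicGeometry.QuasiCompact g], (∀ v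 : V, ∃ (A : Type) (_ : AddCommGroup A) (_ : Finite A) (_ : DecidableEq A) (S : Type) (_ : CommRing S) (_ : Algebra k S) (𝒮 : A → Submodule k S) (_ : GradedAlgebra 𝒮), Algebra.FiniteType k S ∧ Algebra.Smooth k S ∧ ∃ φ : AlgebraicGeometry.Spec (.of (𝒮 0)) ⟶ V, AlgebraicGeometry.Etale φ ∧ v ∈ Set.range φ ∧ φ ≫ g = AlgebraicGeometry.Spec.map (CommRingCat.ofHom (algebraMap k (𝒮 0)))) → Literature.AlgebraicGeometry.Resolution.Scheme.HasResolution V) → ∀ p : ℕ, p.Prime → ∀ (k : Type) [Field k] [CharP k p] [PerfectField k] (X : AlgebraicGeometry.Scheme.{0}) (f : X ⟶ AlgebraicGeometry.Spec (.of k)), AlgebraicGeometry.IsSeparated f → AlgebraicGeometry.LocallyOfFiniteType f → AlgebraicGeometry.QuasiCompact f → AlgebraicGeometry.IsReduced X → Literature.AlgebraicGeometry.Resolution.Scheme.HasResolution X := by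
  intro hC hBR p hp k _ _ _ X f hs hl hq hr
  have C : ∀ e : ℕ, HypersurfaceTowerChoiceDim p e := fun e => Classical.choice (hC p hp e)
  haveI := hs; haveI := hl; haveI := hq; haveI := hr
  exact HypersurfaceTowerChoiceTower.hasResolution_of_towerChoiceDim_field hp C
    (fun V g _ _ _ _ hV => hBR p hp k V g hV) X f

/-- **`WeightedThesis` from TOWER-INDEXED hypersurface centre choices in every transversal dimension and the
characteristic-`p` instances of Bergh–Rydh** (crux stmt-0569, by name;
`perfectResolution_of_hypersurfaceTowerChoiceDim_of_forall_berghRydh_charP` folded): if for every prime `p` and every `e` a tower-indexed choice in transversal dimension `e` exists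
(`Nonempty (HypersurfaceTowerChoiceDim p e)`: a regular weighted centre for every cobordant TOWER — off the
generic point, homogeneous on the charts of the tower — such that extending the runs started at
`e`-dimensional hypersurfaces by their prescribed steps is well-founded; implied by RESHAPE 10's rung through
`HypersurfaceTowerChoiceDim.ofChoiceTDim`, hence by every earlier door and by `WeightedConstruction`; rung
`e = 1` = Abramovich–Quek–Schober arXiv:2507.01232 Thm 1.1 up to language), and for every prime `p` and every
perfect field `k` of characteristic `p` every integral separated finite-type `k`-scheme with finite
diagonalizable quotient singularities étale-locally has a resolution, then every reduced separated scheme of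
finite type over every perfect field of positive characteristic has a resolution.
[cite: Wlodarczyk2022, Thm 1.1.6; BerghRydh2019, Thm 5; AbramovichTemkinWlodarczyk2024, §1.9] -/
theorem weightedThesis_of_hypersurfaceTowerChoiceDim_of_forall_berghRydh_charP : (∀ p : ℕ, p.Prime → ∀ e : ℕ, Nonempty (Summit.ResolutionOfSingularities.ResolutionOfSingularities.Theorems.HypersurfaceTowerChoiceDim p e)) → (∀ p : ℕ, p.Prime → ∀ (k : Type) [Field k] [CharP k p] [PerfectField k] (V : AlgebraicGeometry.Scheme.{0}) (g : V ⟶ AlgebraicGeometry.Spec (.of k)) [AlgebraicGeometry.IsIntegral V] [AlgebraicGeometry.IsSeparated g] [AlgebraicGeometry.LocallyOfFiniteType g] [AlgebraicGeometry.QuasiCompact g], (∀ v : V, ∃ (A : Type) (_ : AddCommGroup A) (_ : Finite A) (_ : DecidableEq A) (S : Type) (_ : CommRing S) (_ : Algebra k S) (𝒮 : A → Submodule k S) (_ : GradedAlgebra 𝒮), Algebra.FiniteType k S ∧ Algebra.Smooth k S ∧ ∃ φ : AlgebraicGeometry.Spec (.of (𝒮 0)) ⟶ V, AlgebraicGeometry.Etale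 φ ∧ v ∈ Set.range φ ∧ φ ≫ g = AlgebraicGeometry.Spec.map (CommRingCat.ofHom (algebraMap k (𝒮 0)))) → Literature.AlgebraicGeometry.Resolution.Scheme.HasResolution V) → Summit.ResolutionOfSingularities.ResolutionOfSingularities.Theses.WeightedInvariant.WeightedThesis :=
  fun hC hBR => perfectResolution_of_hypersurfaceTowerChoiceDim_of_forall_berghRydh_charP hC hBR

/-- **The RESHAPE 10 ladder through the tower-indexed ladder**: tower-typed choices in every transversal
dimension (and a fortiori every earlier door) and prime-wise Bergh–Rydh give `WeightedThesis`, factored through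
`ofChoiceTDim`. [folklore] -/
theorem weightedThesis_of_hypersurfaceChoiceTDim_of_forall_berghRydh_charP' :
    (∀ p : ℕ, p.Prime → ∀ e : ℕ, Nonempty (HypersurfaceCentreChoiceTDim p e)) →
    (∀ p : ℕ, p.Prime → ∀ (k : Type) [Field k] [CharP k p] [PerfectField k] (V : Scheme.{0})
      (g : V ⟶ Spec (.of k)) [IsIntegral V] [IsSeparated g] [LocallyOfFiniteType g] [QuasiCompact g],
      (∀ v : V, ∃ (A : Type) (_ : AddCommGroup A) (_ : Finite A) (_ : DecidableEq A)
        (S : Type) (_ : CommRing S) (_ : Algebra k S) (𝒮 : A → Submodule k S)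
        (_ : GradedAlgebra 𝒮), Algebra.FiniteType k S ∧ Algebra.Smooth k S ∧
        ∃ φ : Spec (.of (𝒮 0)) ⟶ V, Etale φ ∧ v ∈ Set.range φ ∧
          φ ≫ g = Spec.map (CommRingCat.ofHom (algebraMap k (𝒮 0)))) →
      Scheme.HasResolution V) →
    WeightedThesis :=
  fun hC => weightedThesis_of_hypersurfaceTowerChoiceDim_of_forall_berghRydh_charP
    fun p hp e => (hC p hp e).map HypersurfaceTowerChoiceDim.ofChoiceTDim

end Summit.ResolutionOfSingularities.ResolutionOfSingularities.Theorems

end
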